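import Literature.Probability.FitznerVanDerHofstad2017.NobleRemainderBound
import Literature.Probability.FitznerVanDerHofstad2017.NoblePercLetters
import HarnessLib

/-!
# [FvdH17] §3.2 (3.31), §4.4 before (4.65): `Ξ^{B,(N)}` as ONE event on `N+1` independent levels, PROVED

Source: R. Fitzner, R. van der Hofstad, *Mean-field behavior for nearest-neighbor percolation in `d > 10`*,
Electron. J. Probab. **22** (2017) no. 43 [FvdH17] (arXiv:1506.07977v2; equation numbers of arXiv v2 = EJP).
(3.31), p. 27: `Ξ^{B,(N)}_p(x,y;A) = Σ_{b_0,…,b_{N-1}} Π_i J(b_i) 𝔼_0^{B}[𝟙_{E'(x,b̲_0;A) ∩ {b̄_0 ∉ C̃_0}}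
𝔼_1^{b̲_0}[𝟙_{E'(b̄_0,b̲_1;C̃_0) ∩ {b̄_1 ∉ C̃_1}} ⋯ 𝔼_N^{b̲_{N-1}}[𝟙_{E'(b̄_{N-1},y;C̃_{N-1})}] ⋯ ]]`, with
"`C̃_0 = C̃^{b_0}_0(x) ∪ A′` and `C̃_i = C̃^{b_i}_i(b̄_{i-1}) ∪ {b̲_{i-1}}` for `i ≥ 1`" (p. 26) and, §4.4 p. 43
(the sentence before (4.65)): "we recall that each expectation is over an independent percolation configuration
`ω_i`, and `C̃_i` is random in `ω_i` but deterministic in `ω_{i+1}`".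

The tree types `Ξ^{B,(N+1)}(v,x;A)` as the nested integral `nobleXiBT d p B A' (N+1) A v x =
𝒩^{B,A′}(𝒩^{N} nobleKerXi)(A,v,x)` (`Literature.Barriers.CriticalPhenomena.LaceExpansionNobleCoefficients`).
This module PROVES (nothing is cited as a hypothesis; every `[cite:]` tag is provenance) that the nested
integral IS the `ℙ_p^{⊗(N+2)}`-measure of one event on `N+2` independent configurations, summed over the bond
sequence with the weights `Π_i J(b_i)` — the reading of (3.31) quoted above, by Tonelli:

* `nestXi n B A' A v b x ⊆ (Fin (n+2) → BondConfig)` — the EXACT nested event: coordinate `0` lies in the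
  level-`0` cell `nobleCell B A' A v b̲_0 b̄_0`, coordinate `i+1` in the level-`(i+1)` cell read off `B(b̲_i)`
  with the random set `C̃_i ∪ {b̲_i}` of coordinate `i`, the last coordinate in `E'(b̄_n, x; C̃_n ∪ ⋯)` off
  `B(b̲_n)`; `measurableSet_nestXi_prod` (jointly measurable in `(A, ω)`), `measurableSet_nestXi`;
* `nobleXiBT_succ_eq_tsum_pi_nestXi` —
  `Ξ^{B,(n+1)}(v,x;A) = Σ_{b : Fin (n+1) → bonds} (Π_i J(b_i)) · ℙ_p^{⊗(n+2)}(nestXi n B A' A v b x)`,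
  for ALL outer data `(B, A′)` (so it serves `Ξ^{(N)} = Ξ^{∅,(N)}(0,x;{0})`, the parts `Ξ^{{b_ι},(N)}(0,x;{e_ι})`
  of `Ξ^{(N),ι}`, and every inner level);
* `nobleXiT_succ_succ_eq_tsum` — `Ξ^{(M+2)}_p(x) = Σ_b (Π J) · ℙ_p^{⊗(M+3)}(nestXi (M+1) ∅ ∅ {0} 0 b x)`.

ROLE (b2b-lace LEMMAS §25 node N76-X2, ADDENDUM 10): this is the object the multi-level JOINT witnessed event
of the bound (6.49) for `N ≥ 2` has to cover, exactly as `NobleJointTwoLevel.twoLevel` /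
`nobleXiT_one_eq_tsum_prod` was covered by `jointWit` at `N = 1`.

Tools (§A): the disintegration of `Measure.pi` over `Fin (m+1)` along the first coordinate
(`pi_succ_apply_eq_lintegral`, from `measurePreserving_piFinSuccAbove`) and `Measure.pi` over `Fin 1`
(`pi_fin_one_apply`).
-/

noncomputable section

namespace Literature.Probability.FitznerVanDerHofstad2017

open _root_.MeasureTheory Literature.Barriers.CriticalPhenomena Literature.Probability.Percolation
open Literature.Probability.LatticeModels _root_.SimpleGraph
open Literature.Probability.FitznerVanDerHofstad2017.NobleBlocks (piPerc)
open scoped ENNReal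

variable {d : ℕ}

/-! ### A. Product measures over `Fin (m+1)` coordinates: peeling off the first coordinate -/

section PiTools

variable {X : Type*} [MeasurableSpace X]

/-- `(a, f) ↦ Fin.cons a f` is measurable. [folklore] -/
theorem measurable_finCons (m : ℕ) :
    Measurable fun q : X × (Fin m → X) => (Fin.cons q.1 q.2 : Fin (m + 1) → X) := by
  refine measurable_pi_lambda _ fun i => ?_
  refine Fin.cases ?_ (fun j => ?_) i
  · simpa only [Fin.cons_zero] using measurable_fst
  · simp only [Fin.cons_succ]
    exact (measurable_pi_apply j).comp measurable_snd

/-- Sections of a measurable set along `Fin.cons` are measurable. [folklore] -/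
theorem measurableSet_finCons_section {m : ℕ} {S : Set (Fin (m + 1) → X)} (hS : MeasurableSet S) (a : X) :
    MeasurableSet {f : Fin m → X | Fin.cons a f ∈ S} :=
  (hS.preimage (measurable_finCons m)).preimage measurable_prodMk_left

/-- The measure of the `Fin.cons`-sections of a measurable set is a measurable function of the first
coordinate. [folklore] -/
theorem measurable_pi_finCons_section (μ : Measure X) [SigmaFinite μ] {m : ℕ} {S : Set (Fin (m + 1) → X)}
    (hS : MeasurableSet S) :
    Measurable fun a => Measure.pi (fun _ : Fin m => μ) {f : Fin m → X | Fin.cons a f ∈ S} :=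
  measurable_measure_prodMk_left (hS.preimage (measurable_finCons m))

/-- **Disintegration of `μ^{⊗(m+1)}` along the first coordinate**:
`μ^{⊗(m+1)}(S) = ∫ μ^{⊗m}({f | (a, f) ∈ S}) dμ(a)`. [folklore] -/
theorem pi_succ_apply_eq_lintegral (μ : Measure X) [SigmaFinite μ] {m : ℕ} {S : Set (Fin (m + 1) → X)}
    (hS : MeasurableSet S) :
    Measure.pi (fun _ : Fin (m + 1) => μ) S =
      ∫⁻ a, Measure.pi (fun _ : Fin m => μ) {f : Fin m → X | Fin.cons a f ∈ S} ∂μ := by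
  have hmp := measurePreserving_piFinSuccAbove (fun _ : Fin (m + 1) => μ) 0
  have he : ∀ q : X × (Fin m → X),
      (MeasurableEquiv.piFinSuccAbove (fun _ : Fin (m + 1) => X) 0).symm q = Fin.cons q.1 q.2 := by
    intro q
    simp [MeasurableEquiv.piFinSuccAbove, Fin.insertNthEquiv, Fin.insertNth_zero']
  have h1 := hmp.measure_preimage_equiv
    ((MeasurableEquiv.piFinSuccAbove (fun _ : Fin (m + 1) => X) 0).symm ⁻¹' S)
  have h2 : (MeasurableEquiv.piFinSuccAbove (fun _ : Fin (m + 1) => X) 0) ⁻¹'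
      ((MeasurableEquiv.piFinSuccAbove (fun _ : Fin (m + 1) => X) 0).symm ⁻¹' S) = S := by
    ext f
    simp only [Set.mem_preimage, MeasurableEquiv.symm_apply_apply]
  rw [h2] at h1
  rw [h1, Measure.prod_apply (hS.preimage (MeasurableEquiv.measurable _))]
  refine lintegral_congr fun a => ?_
  have hs : Prod.mk a ⁻¹' ((MeasurableEquiv.piFinSuccAbove (fun _ : Fin (m + 1) => X) 0).symm ⁻¹' S) =
      {f : Fin m → X | Fin.cons a f ∈ S} := by
    ext f
    simp only [Set.mem_preimage, Set.mem_setOf_eq, he]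
  rw [hs]

/-- `μ^{⊗1}({f | f 0 ∈ T}) = μ(T)`. [folklore] -/
theorem pi_fin_one_apply (μ : Measure X) [SigmaFinite μ] (T : Set X) :
    Measure.pi (fun _ : Fin 1 => μ) {f : Fin 1 → X | f 0 ∈ T} = μ T := by
  have h := (measurePreserving_funUnique μ (Fin 1)).measure_preimage_equiv T
  have he : (MeasurableEquiv.funUnique (Fin 1) X) ⁻¹' T = {f : Fin 1 → X | f 0 ∈ T} := by
    ext f
    simp only [Set.mem_preimage, Set.mem_setOf_eq, MeasurableEquiv.funUnique_apply, Fin.default_eq_zero]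
  rw [he] at h
  exact h

end PiTools

/-! ### B. The bond weights and the exact nested event -/

/-- `Π_i J(b_i)` for a bond sequence `b` (`J(u′ − u) = p 𝟙{u ∼ u′}`).
[cite: FitznerVanDerHofstad2017, (3.31) (arXiv:1506.07977v2 p. 27)] -/
def bondJProd (d : ℕ) (p : unitInterval) {m : ℕ} (b : Fin m → Site d × Site d) : ℝ≥0∞ :=
  ∏ i, ENNReal.ofReal (bondJ d p ((b i).2 - (b i).1))

/-- `Π J` over one bond. [folklore] -/
theorem bondJProd_one (p : unitInterval) (b : Fin 1 → Site d × Site d) :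
    bondJProd d p b = ENNReal.ofReal (bondJ d p ((b 0).2 - (b 0).1)) := by
  simp only [bondJProd, Fin.prod_univ_one]

/-- `Π J` of `Fin.cons b₀ b` = `J(b₀) · Π J(b)`. [folklore] -/
theorem bondJProd_cons (p : unitInterval) {m : ℕ} (b₀ : Site d × Site d) (b : Fin m → Site d × Site d) :
    bondJProd d p (Fin.cons b₀ b : Fin (m + 1) → Site d × Site d) =
      ENNReal.ofReal (bondJ d p (b₀.2 - b₀.1)) * bondJProd d p b := by
  simp only [bondJProd, Fin.prod_univ_succ, Fin.cons_zero, Fin.cons_succ]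

/-- A sum over sequences of length `m+1` is the iterated sum over the head and the tail. [folklore] -/
theorem tsum_eq_tsum_finCons {β : Type*} {m : ℕ} (F : (Fin (m + 1) → β) → ℝ≥0∞) :
    ∑' c : Fin (m + 1) → β, F c = ∑' b₀ : β, ∑' b : Fin m → β, F (Fin.cons b₀ b) := by
  rw [← Equiv.tsum_eq (Fin.consEquiv fun _ : Fin (m + 1) => β) F, ENNReal.tsum_prod']
  rfl

/-- **The exact nested event of `Ξ^{B,(n+1)}(v,x;A)`** for the bond sequence `b = (b_0,…,b_n)`, on `n+2`
independent configurations `ω_0,…,ω_{n+1}`: `ω_0 ∈ nobleCell B A' A v b̲_0 b̄_0` (level `0`: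
`E'(v,b̲_0;A)` off `B` and `b̄_0 ∉ C̃^{b_0}(v) ∪ A′`), and `(ω_1,…,ω_{n+1})` in the nested event of the inner
levels with outer data `(B(b̲_0), {b̲_0})`, set `C̃^{b_0}(v)(ω_0 off B) ∪ A′` and start `b̄_0`; at `n = 0` the
inner level is the last one, `(ω_1)_{B(b̲_0)ᶜ} ∈ E'(b̄_0, x; C̃_0)`.
[cite: FitznerVanDerHofstad2017, (3.26), (3.31) (arXiv:1506.07977v2 pp. 26–27)] -/
def nestXi : (n : ℕ) → Set (Sym2 (Site d)) → Set (Site d) → Set (Site d) → Site d →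
    (Fin (n + 1) → Site d × Site d) → Site d → Set (Fin (n + 2) → BondConfig (Site d))
  | 0, B, A', A, v, b, x => {ω | ω 0 ∈ nobleCell B A' A v (b 0).1 (b 0).2 ∧
      offBonds (bondsAt {(b 0).1}) (ω 1) ∈
        laceE (restrCluster (b 0).1 (b 0).2 v (offBonds B (ω 0)) ∪ A') (b 0).2 x}
  | n + 1, B, A', A, v, b, x => {ω | ω 0 ∈ nobleCell B A' A v (b 0).1 (b 0).2 ∧
      (fun i : Fin (n + 2) => ω i.succ) ∈ nestXi n (bondsAt {(b 0).1}) {(b 0).1}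
        (restrCluster (b 0).1 (b 0).2 v (offBonds B (ω 0)) ∪ A') (b 0).2 (fun i : Fin (n + 1) => b i.succ) x}

/-- Unfolding lemma (`n = 0`). [folklore] -/
theorem mem_nestXi_zero_iff (B : Set (Sym2 (Site d))) (A' A : Set (Site d)) (v : Site d)
    (b : Fin 1 → Site d × Site d) (x : Site d) (ω : Fin 2 → BondConfig (Site d)) :
    ω ∈ nestXi 0 B A' A v b x ↔ ω 0 ∈ nobleCell B A' A v (b 0).1 (b 0).2 ∧
      offBonds (bondsAt {(b 0).1}) (ω 1) ∈
        laceE (restrCluster (b 0).1 (b 0).2 v (offBonds B (ω 0)) ∪ A') (b 0).2 x :=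
  Iff.rfl

/-- Unfolding lemma (`n + 1`). [folklore] -/
theorem mem_nestXi_succ_iff (n : ℕ) (B : Set (Sym2 (Site d))) (A' A : Set (Site d)) (v : Site d)
    (b : Fin (n + 2) → Site d × Site d) (x : Site d) (ω : Fin (n + 3) → BondConfig (Site d)) :
    ω ∈ nestXi (n + 1) B A' A v b x ↔ ω 0 ∈ nobleCell B A' A v (b 0).1 (b 0).2 ∧
      (fun i : Fin (n + 2) => ω i.succ) ∈ nestXi n (bondsAt {(b 0).1}) {(b 0).1}
        (restrCluster (b 0).1 (b 0).2 v (offBonds B (ω 0)) ∪ A') (b 0).2 (fun i : Fin (n + 1) => b i.succ) x :=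
  Iff.rfl

/-! ### C. Measurability -/

/-- The nested event is jointly measurable in `(A, ω)` ("`C̃_i` is random in `ω_i` but deterministic in
`ω_{i+1}`"). [cite: FitznerVanDerHofstad2017, §4.4, sentence before (4.65) (arXiv:1506.07977v2 p. 43)] -/
theorem measurableSet_nestXi_prod (n : ℕ) :
    ∀ (B : Set (Sym2 (Site d))) (A' : Set (Site d)) (v : Site d) (b : Fin (n + 1) → Site d × Site d)
      (x : Site d),
      MeasurableSet {q : Set (Site d) × (Fin (n + 2) → BondConfig (Site d)) | q.2 ∈ nestXi n B A' q.1 v b x} := by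
  induction n with
  | zero =>
    intro B A' v b x
    have h1 : MeasurableSet {q : Set (Site d) × (Fin 2 → BondConfig (Site d)) |
        q.2 0 ∈ nobleCell B A' q.1 v (b 0).1 (b 0).2} :=
      (measurableSet_nobleCell_prod B A' v (b 0).1 (b 0).2).preimage
        (measurable_fst.prodMk ((measurable_pi_apply 0).comp measurable_snd))
    have h2 : MeasurableSet {q : Set (Site d) × (Fin 2 → BondConfig (Site d)) |
        offBonds (bondsAt {(b 0).1}) (q.2 1) ∈
          laceE (restrCluster (b 0).1 (b 0).2 v (offBonds B (q.2 0)) ∪ A') (b 0).2 x} :=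
      measurableSet_laceE_comp
        ((measurable_restrCluster_offBonds B A' (b 0).1 (b 0).2 v).comp
          ((measurable_pi_apply 0).comp measurable_snd))
        ((measurable_offBonds (bondsAt {(b 0).1})).comp ((measurable_pi_apply 1).comp measurable_snd))
        (b 0).2 x
    exact h1.inter h2
  | succ n ih =>
    intro B A' v b x
    have h1 : MeasurableSet {q : Set (Site d) × (Fin (n + 3) → BondConfig (Site d)) |
        q.2 0 ∈ nobleCell B A' q.1 v (b 0).1 (b 0).2} :=
      (measurableSet_nobleCell_prod B A' v (b 0).1 (b 0).2).preimage
        (measurable_fst.prodMk ((measurable_pi_apply 0).comp measurable_snd))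
    have h2 : MeasurableSet {q : Set (Site d) × (Fin (n + 3) → BondConfig (Site d)) |
        (fun i : Fin (n + 2) => q.2 i.succ) ∈ nestXi n (bondsAt {(b 0).1}) {(b 0).1}
          (restrCluster (b 0).1 (b 0).2 v (offBonds B (q.2 0)) ∪ A') (b 0).2
          (fun i : Fin (n + 1) => b i.succ) x} :=
      (ih (bondsAt {(b 0).1}) {(b 0).1} (b 0).2 (fun i => b i.succ) x).preimage
        (((measurable_restrCluster_offBonds B A' (b 0).1 (b 0).2 v).comp
            ((measurable_pi_apply 0).comp measurable_snd)).prodMk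
          (measurable_pi_lambda _ fun i => (measurable_pi_apply i.succ).comp measurable_snd))
    exact h1.inter h2

/-- The nested event is measurable. [cite: FitznerVanDerHofstad2017, (3.31) (arXiv:1506.07977v2 p. 27)] -/
theorem measurableSet_nestXi (n : ℕ) (B : Set (Sym2 (Site d))) (A' A : Set (Site d)) (v : Site d)
    (b : Fin (n + 1) → Site d × Site d) (x : Site d) : MeasurableSet (nestXi n B A' A v b x) :=
  (measurableSet_nestXi_prod n B A' v b x).preimage (measurable_const.prodMk measurable_id)

/-! ### D. The sections of the nested event along the level-`0` configuration -/

/-- Level-`0` section, `n = 0`: for `ω_0` in the cell the section is `{(ω_1)_{B(b̲_0)ᶜ} ∈ E'(b̄_0,x;C̃_0)}`,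
whose `ℙ_p`-measure is the innermost kernel `nobleKerXi`; otherwise it is empty.
[cite: FitznerVanDerHofstad2017, (3.31) (arXiv:1506.07977v2 p. 27)] -/
theorem pi_finCons_section_nestXi_zero (p : unitInterval) (B : Set (Sym2 (Site d))) (A' A : Set (Site d))
    (v : Site d) (b : Fin 1 → Site d × Site d) (x : Site d) (ω₀ : BondConfig (Site d)) :
    piPerc d p 1 {f : Fin 1 → BondConfig (Site d) | Fin.cons ω₀ f ∈ nestXi 0 B A' A v b x} =
      (nobleCell B A' A v (b 0).1 (b 0).2).indicator
        (fun ω₀ => nobleKerXi d p (b 0).1 (restrCluster (b 0).1 (b 0).2 v (offBonds B ω₀) ∪ A') (b 0).2 x)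
        ω₀ := by
  by_cases h : ω₀ ∈ nobleCell B A' A v (b 0).1 (b 0).2
  · rw [Set.indicator_of_mem h, nobleKerXi_apply, probOff_def]
    have e : {f : Fin 1 → BondConfig (Site d) | Fin.cons ω₀ f ∈ nestXi 0 B A' A v b x} =
        {f : Fin 1 → BondConfig (Site d) | f 0 ∈ occursOff (bondsAt {(b 0).1})
          (laceE (restrCluster (b 0).1 (b 0).2 v (offBonds B ω₀) ∪ A') (b 0).2 x)} := by
      ext f
      rw [Set.mem_setOf_eq, Set.mem_setOf_eq, mem_nestXi_zero_iff, mem_occursOff_iff]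
      simp only [Fin.cons_zero, Fin.cons_one, h, true_and]
    rw [e]
    exact pi_fin_one_apply _ _
  · rw [Set.indicator_of_notMem h]
    have e : {f : Fin 1 → BondConfig (Site d) | Fin.cons ω₀ f ∈ nestXi 0 B A' A v b x} = ∅ := by
      ext f
      rw [Set.mem_setOf_eq, mem_nestXi_zero_iff, Set.mem_empty_iff_false, iff_false, not_and]
      intro h0
      exact absurd (by simpa only [Fin.cons_zero] using h0) h
    rw [e, measure_empty]

/-- Level-`0` section, `n + 1`: for `ω_0` in the cell the section is the nested event of the inner levels
with the set `C̃^{b_0}(v)(ω_0 off B) ∪ A′`; otherwise it is empty.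
[cite: FitznerVanDerHofstad2017, (3.31) (arXiv:1506.07977v2 p. 27)] -/
theorem pi_finCons_section_nestXi_succ (p : unitInterval) (n : ℕ) (B : Set (Sym2 (Site d)))
    (A' A : Set (Site d)) (v : Site d) (b₀ : Site d × Site d) (b : Fin (n + 1) → Site d × Site d) (x : Site d)
    (ω₀ : BondConfig (Site d)) :
    piPerc d p (n + 2) {f : Fin (n + 2) → BondConfig (Site d) |
        Fin.cons ω₀ f ∈ nestXi (n + 1) B A' A v (Fin.cons b₀ b) x} =
      (nobleCell B A' A v b₀.1 b₀.2).indicator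
        (fun ω₀ => piPerc d p (n + 2) (nestXi n (bondsAt {b₀.1}) {b₀.1}
          (restrCluster b₀.1 b₀.2 v (offBonds B ω₀) ∪ A') b₀.2 b x)) ω₀ := by
  by_cases h : ω₀ ∈ nobleCell B A' A v b₀.1 b₀.2
  · rw [Set.indicator_of_mem h]
    have e : {f : Fin (n + 2) → BondConfig (Site d) |
        Fin.cons ω₀ f ∈ nestXi (n + 1) B A' A v (Fin.cons b₀ b) x} =
        nestXi n (bondsAt {b₀.1}) {b₀.1} (restrCluster b₀.1 b₀.2 v (offBonds B ω₀) ∪ A') b₀.2 b x := by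
      ext f
      rw [Set.mem_setOf_eq, mem_nestXi_succ_iff]
      simp only [Fin.cons_zero, Fin.cons_succ, h, true_and]
    rw [e]
  · rw [Set.indicator_of_notMem h]
    have e : {f : Fin (n + 2) → BondConfig (Site d) |
        Fin.cons ω₀ f ∈ nestXi (n + 1) B A' A v (Fin.cons b₀ b) x} = ∅ := by
      ext f
      rw [Set.mem_setOf_eq, mem_nestXi_succ_iff, Set.mem_empty_iff_false, iff_false, not_and]
      intro h0
      exact absurd (by simpa only [Fin.cons_zero] using h0) h
    rw [e, measure_empty]

/-! ### E. The exact product representation -/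

/-- **`Ξ^{B,(n+1)}(v,x;A) = Σ_b (Π_i J(b_i)) · ℙ_p^{⊗(n+2)}(nestXi n B A' A v b x)`** — the nested
expectations (3.31) are the measure of one event on `n+2` independent configurations (Tonelli, level by
level). [cite: FitznerVanDerHofstad2017, (3.31) (arXiv:1506.07977v2 p. 27); §4.4 before (4.65) (p. 43)] -/
theorem nobleXiBT_succ_eq_tsum_pi_nestXi (p : unitInterval) (n : ℕ) :
    ∀ (B : Set (Sym2 (Site d))) (A' A : Set (Site d)) (v x : Site d),
      nobleXiBT d p B A' (n + 1) A v x =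
        ∑' b : Fin (n + 1) → Site d × Site d, bondJProd d p b * piPerc d p (n + 2) (nestXi n B A' A v b x) := by
  induction n with
  | zero =>
    intro B A' A v x
    rw [nobleXiBT_succ, nobleOp_apply, nobleIter_zero]
    have hR : ∀ b : Fin 1 → Site d × Site d,
        bondJProd d p b * piPerc d p 2 (nestXi 0 B A' A v b x) =
          ENNReal.ofReal (bondJ d p ((b 0).2 - (b 0).1)) *
            ∫⁻ ω, (nobleCell B A' A v (b 0).1 (b 0).2).indicator
              (fun ω => nobleKerXi d p (b 0).1 (restrCluster (b 0).1 (b 0).2 v (offBonds B ω) ∪ A') (b 0).2 x)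
              ω ∂(bondPercolation (zdGraph d) p) := by
      intro b
      rw [bondJProd_one]
      congr 1
      rw [piPerc, pi_succ_apply_eq_lintegral _ (measurableSet_nestXi 0 B A' A v b x)]
      refine lintegral_congr fun ω => ?_
      exact pi_finCons_section_nestXi_zero p B A' A v b x ω
    simp_rw [hR]
    rw [← Equiv.tsum_eq (Equiv.funUnique (Fin 1) (Site d × Site d))]
    rfl
  | succ n ih =>
    intro B A' A v x
    rw [nobleXiBT_succ, nobleOp_apply]
    have hI : ∀ (b₀ : Site d × Site d) (ω : BondConfig (Site d)),
        nobleIter d p (nobleKerXi d p) (n + 1) b₀.1 (restrCluster b₀.1 b₀.2 v (offBonds B ω) ∪ A') b₀.2 x =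
          ∑' b : Fin (n + 1) → Site d × Site d, bondJProd d p b *
            piPerc d p (n + 2) (nestXi n (bondsAt {b₀.1}) {b₀.1}
              (restrCluster b₀.1 b₀.2 v (offBonds B ω) ∪ A') b₀.2 b x) := by
      intro b₀ ω
      rw [nobleIter_succ, nobleOpW_apply, ← nobleXiBT_succ]
      exact ih _ _ _ _ _
    have hJ : ∀ b₀ : Site d × Site d,
        ∫⁻ ω, (nobleCell B A' A v b₀.1 b₀.2).indicator
            (fun ω => nobleIter d p (nobleKerXi d p) (n + 1) b₀.1
              (restrCluster b₀.1 b₀.2 v (offBonds B ω) ∪ A') b₀.2 x) ω ∂(bondPercolation (zdGraph d) p) =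
          ∑' b : Fin (n + 1) → Site d × Site d, bondJProd d p b *
            piPerc d p (n + 3) (nestXi (n + 1) B A' A v (Fin.cons b₀ b) x) := by
      intro b₀
      have hm : ∀ b : Fin (n + 1) → Site d × Site d, Measurable fun ω : BondConfig (Site d) =>
          (nobleCell B A' A v b₀.1 b₀.2).indicator
            (fun ω => piPerc d p (n + 2) (nestXi n (bondsAt {b₀.1}) {b₀.1}
              (restrCluster b₀.1 b₀.2 v (offBonds B ω) ∪ A') b₀.2 b x)) ω := by
        intro b
        have e : (fun ω : BondConfig (Site d) => (nobleCell B A' A v b₀.1 b₀.2).indicator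
            (fun ω => piPerc d p (n + 2) (nestXi n (bondsAt {b₀.1}) {b₀.1}
              (restrCluster b₀.1 b₀.2 v (offBonds B ω) ∪ A') b₀.2 b x)) ω) =
            fun ω => piPerc d p (n + 2) {f : Fin (n + 2) → BondConfig (Site d) |
              Fin.cons ω f ∈ nestXi (n + 1) B A' A v (Fin.cons b₀ b) x} :=
          funext fun ω => (pi_finCons_section_nestXi_succ p n B A' A v b₀ b x ω).symm
        rw [e]
        exact measurable_pi_finCons_section _ (measurableSet_nestXi (n + 1) B A' A v (Fin.cons b₀ b) x)
      calc ∫⁻ ω, (nobleCell B A' A v b₀.1 b₀.2).indicator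
              (fun ω => nobleIter d p (nobleKerXi d p) (n + 1) b₀.1
                (restrCluster b₀.1 b₀.2 v (offBonds B ω) ∪ A') b₀.2 x) ω ∂(bondPercolation (zdGraph d) p)
          = ∫⁻ ω, ∑' b : Fin (n + 1) → Site d × Site d, bondJProd d p b *
              (nobleCell B A' A v b₀.1 b₀.2).indicator
                (fun ω => piPerc d p (n + 2) (nestXi n (bondsAt {b₀.1}) {b₀.1}
                  (restrCluster b₀.1 b₀.2 v (offBonds B ω) ∪ A') b₀.2 b x)) ω
              ∂(bondPercolation (zdGraph d) p) := by
            refine lintegral_congr fun ω => ?_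
            simp_rw [hI]
            exact indicator_tsum_mul _ _ _ _
        _ = ∑' b : Fin (n + 1) → Site d × Site d, ∫⁻ ω, bondJProd d p b *
              (nobleCell B A' A v b₀.1 b₀.2).indicator
                (fun ω => piPerc d p (n + 2) (nestXi n (bondsAt {b₀.1}) {b₀.1}
                  (restrCluster b₀.1 b₀.2 v (offBonds B ω) ∪ A') b₀.2 b x)) ω
              ∂(bondPercolation (zdGraph d) p) :=
            lintegral_tsum fun b => ((hm b).const_mul _).aemeasurable
        _ = ∑' b : Fin (n + 1) → Site d × Site d, bondJProd d p b *
              ∫⁻ ω, (nobleCell B A' A v b₀.1 b₀.2).indicator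
                (fun ω => piPerc d p (n + 2) (nestXi n (bondsAt {b₀.1}) {b₀.1}
                  (restrCluster b₀.1 b₀.2 v (offBonds B ω) ∪ A') b₀.2 b x)) ω
              ∂(bondPercolation (zdGraph d) p) :=
            tsum_congr fun b => lintegral_const_mul _ (hm b)
        _ = ∑' b : Fin (n + 1) → Site d × Site d, bondJProd d p b *
              piPerc d p (n + 3) (nestXi (n + 1) B A' A v (Fin.cons b₀ b) x) := by
            refine tsum_congr fun b => ?_
            congr 1
            unfold piPerc
            rw [pi_succ_apply_eq_lintegral _ (measurableSet_nestXi (n + 1) B A' A v (Fin.cons b₀ b) x)]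
            refine lintegral_congr fun ω => ?_
            exact (pi_finCons_section_nestXi_succ p n B A' A v b₀ b x ω).symm
    simp_rw [hJ]
    rw [tsum_eq_tsum_finCons]
    refine tsum_congr fun b₀ => ?_
    rw [← ENNReal.tsum_mul_left]
    refine tsum_congr fun b => ?_
    simp only [bondJProd_cons, mul_assoc]

/-- **`Ξ^{(M+2)}_p(x) = Σ_b (Π J) · ℙ_p^{⊗(M+3)}(nestXi (M+1) ∅ ∅ {0} 0 b x)`** (`Ξ^{(N)} = Ξ^{∅,(N)}(0,x;{0})`,
(3.43)). [cite: FitznerVanDerHofstad2017, (3.31), (3.43) (arXiv:1506.07977v2 pp. 27–28)] -/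
theorem nobleXiT_succ_succ_eq_tsum (p : unitInterval) (M : ℕ) (x : Site d) :
    nobleXiT d p (M + 2) x = ∑' b : Fin (M + 2) → Site d × Site d,
      bondJProd d p b * piPerc d p (M + 3) (nestXi (M + 1) ∅ ∅ {0} 0 b x) := by
  have h : nobleXiT d p (M + 2) x = nobleXiBT d p ∅ ∅ (M + 2) {0} 0 x := by simp [nobleXiT]
  rw [h]
  exact nobleXiBT_succ_eq_tsum_pi_nestXi p (M + 1) ∅ ∅ {0} 0 x

/-- The same at `N = 1` (`M+2` replaced by `1`; cf. `NobleJointTwoLevel.nobleXiT_one_eq_tsum_prod`, the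
two-level form on `BondConfig × BondConfig`). [cite: FitznerVanDerHofstad2017, (3.31), (3.43) (arXiv:1506.07977v2 pp. 27–28)] -/
theorem nobleXiT_one_eq_tsum_pi_nestXi (p : unitInterval) (x : Site d) :
    nobleXiT d p 1 x = ∑' b : Fin 1 → Site d × Site d,
      bondJProd d p b * piPerc d p 2 (nestXi 0 ∅ ∅ {0} 0 b x) := by
  have h : nobleXiT d p 1 x = nobleXiBT d p ∅ ∅ 1 {0} 0 x := by simp [nobleXiT]
  rw [h]
  exact nobleXiBT_succ_eq_tsum_pi_nestXi p 0 ∅ ∅ {0} 0 x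

end Literature.Probability.FitznerVanDerHofstad2017
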